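import Mathlib.Analysis.SpecialFunctions.Pow.Real
import HarnessLib

/-!
# Venture YMGap — track (c) «DS», the vertex-STAR window: the received-sum function `R(β_W)` in
# closed form, its monotonicity in the one-link constants, and the kernel-checked rows `R < 1`

HONEST FRAMING: venture file (cell `pub-ymgap`, QuantumFields programme), strong-coupling LATTICE
bookkeeping only (currency SC-a).  This file is PURE REAL ARITHMETIC: it defines the closed-form
received sum of the cell's star-window analysis (`STAR-DOOR.md` §4 / `STAR-PROOF.md` (P6.1)),

  `R(β; τ₅, κ_q, Λ₃) = 6c + (B − P)·Φ₁(c) + P·Φ₂(c)`,  `c = β/4`,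
  `u = 1/(1 − 6c)`, `v = 1/(1 + 2c)`, `Φ₁ = u(21/4 + 9c/2) + v(3/4 + 3c/2)`,
  `Φ₂ = 9(1 + c)(3u + v) + 36 c u v`, `B = βτ₅/4 + κ_q βc + β³Λ₃/2`, `P = βc/4 + β³Λ₃/3`,

proves that it is monotone in the three one-link constants `τ₅` (the von Mises–Fisher mean resultant
length at tilt `5β`), `κ_q` (the quadratic Kantorovich weight `√(V₄/3)`) and `Λ₃` (the third-cumulant
norm on tilts `≤ 6β`), and checks by `norm_num` the rows `R < 1` at the Wilson couplings
`β_W ∈ {2/9, 1/4, 4/15, 27/100, 11/40, 277/1000, 139/500}` for the certified upper bounds of the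
cell's table (`STAR-CERT.md`: `κ_q ≤ 0.336`, `Λ₃ ≤ 0.066`, `τ₅` per row).

WHAT THIS IS NOT.  It does NOT prove that `R` bounds anything: the analytic statement «the star
window kernels of the `SU(2)`, `d = 4` Wilson specification satisfy the vector Kantorovich
contraction `DSWindow.IsWindowKRContraction` with an array whose received sums are `R(β_W)`»
is the cell's LEMMA S (pen-and-paper, class A, audit pending) and is NOT asserted here; nor are the
certified constants asserted (they enter as hypotheses `τ₅ ≤ …`).  With Lemma S, the tree's window
theorem `Literature.Probability.LatticeModels.DobrushinShlosman.abs_covariance_le`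
(re-exported as `Summit.Ventures.YMGap.DSWindow.Certificate.abs_covariance_le`) turns a row
`R(β_W) < 1` into exponential clustering of local observables at that `β_W` — a strong-coupling
lattice statement; nothing about confinement, the continuum or the Yang–Mills mass gap.

## Contents
* `u`, `v`, `Phi1`, `Phi2`, `Bcoef`, `Pcoef`, `starR` — the closed form;
* `starR_eq_affine` — `R` is affine in `(τ₅, κ_q, Λ₃)` with the displayed coefficients;
* `u_pos`, `v_pos`, `Phi1_pos`, `Phi2_pos` (for `0 ≤ β < 2/3`), `starR_mono` — monotonicity;
* `starR_lt_one_of_le` — the generic row lemma; the seven rows `starR_twoNinths_lt_one`, …,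
  `starR_139_500_lt_one`; and the closed row `one_le_starR_twoSevenths_of_ge`: at `β_W = 2/7` the
  closed form is `≥ 1` as soon as `τ₅ ≥ 0.33`, `κ_q ≥ 1/3`, `Λ₃ ≥ 0` (true for the actual constants:
  `τ(10/7) = 0.3302`, `κ_q ≥ √(V₄(Haar)/3) = 1/3`), i.e. THIS bookkeeping does not reach `2/7`.

References (lineage of the bookkeeping, not of this arithmetic): R. L. Dobrushin, Theory Probab.
Appl. 15 (1970) Thm. 3; H. Föllmer, LNM 1362 (1988) Ch. I (2.8)–(2.10), Rem. (2.17);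
R. L. Dobrushin, S. B. Shlosman (1985) condition `C_V`.
-/

noncomputable section

namespace Summit.Ventures.YMGap.StarWindow

/-! ### The closed form -/

/-- The resolvent factor `u(c) = 1/(1 − 6c)` of the star's internal Dobrushin matrix on the constant
vector (row sums `6c`). [folklore] -/
def u (c : ℝ) : ℝ := 1 / (1 - 6 * c)

/-- The resolvent factor `v(c) = 1/(1 + 2c)` of the star's internal Dobrushin matrix on the
even, mean-zero sector (eigenvalue `−2c`). [folklore] -/
def v (c : ℝ) : ℝ := 1 / (1 + 2 * c)

/-- `Φ₁(c) = u(21/4 + 9c/2) + v(3/4 + 3c/2)` — the propagation factor multiplying `B − P` in the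
received sum (`= 6cE₂ + 6(u − d₁)`, `STAR-PROOF.md` (P6.1)). [folklore] -/
def Phi1 (c : ℝ) : ℝ := u c * (21 / 4 + 9 / 2 * c) + v c * (3 / 4 + 3 / 2 * c)

/-- `Φ₂(c) = 9(1 + c)(3u + v) + 36cuv` — the propagation factor multiplying `P` in the received sum
(`= 36(1 + c)E₂ + 6E₁`, `STAR-PROOF.md` (P6.1)). [folklore] -/
def Phi2 (c : ℝ) : ℝ := 9 * (1 + c) * (3 * u c + v c) + 36 * c * u c * v c

/-- `B = βτ₅/4 + κ_q·β·c + β³Λ₃/2` (`c = β/4`): the one-site Kantorovich weight of the partner link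
`b` in Lemma S (linear part `K̄βτ(5β)`, quadratic part `κ_q βc`, Taylor remainder `(3/2)·(1/3)·β³Λ₃`).
[folklore] -/
def Bcoef (β τ₅ κq Λ₃ : ℝ) : ℝ := β * τ₅ / 4 + κq * β * (β / 4) + β ^ 3 * Λ₃ / 2

/-- `P = βc/4 + β³Λ₃/3` (`c = β/4`): the one-site Kantorovich weight of each of the five other
partners in Lemma S. [folklore] -/
def Pcoef (β Λ₃ : ℝ) : ℝ := β * (β / 4) / 4 + β ^ 3 * Λ₃ / 3

/-- **The star received sum** `R(β; τ₅, κ_q, Λ₃) = 6c + (B − P)Φ₁(c) + PΦ₂(c)`, `c = β/4`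
(`STAR-PROOF.md` (P6.1)). [folklore] -/
def starR (β τ₅ κq Λ₃ : ℝ) : ℝ :=
  6 * (β / 4) + (Bcoef β τ₅ κq Λ₃ - Pcoef β Λ₃) * Phi1 (β / 4) + Pcoef β Λ₃ * Phi2 (β / 4)

/-! ### Affine structure and monotonicity -/

/-- `R` is affine in the three constants:
`R = [6c + (Φ₂ − Φ₁)βc/4] + (Φ₁β/4)·τ₅ + (Φ₁βc)·κ_q + (Φ₁/6 + Φ₂/3)β³·Λ₃`. [folklore] -/
theorem starR_eq_affine (β τ₅ κq Λ₃ : ℝ) :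
    starR β τ₅ κq Λ₃ =
      (6 * (β / 4) + (Phi2 (β / 4) - Phi1 (β / 4)) * (β * (β / 4) / 4)) +
        Phi1 (β / 4) * β / 4 * τ₅ + Phi1 (β / 4) * β * (β / 4) * κq +
          (Phi1 (β / 4) / 6 + Phi2 (β / 4) / 3) * β ^ 3 * Λ₃ := by
  unfold starR Bcoef Pcoef
  ring

/-- `u(c) > 0` for `6c < 1`. [folklore] -/
theorem u_pos {c : ℝ} (hc : 6 * c < 1) : 0 < u c := by
  unfold u
  exact div_pos one_pos (by linarith)

/-- `v(c) > 0` for `c ≥ 0`. [folklore] -/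
theorem v_pos {c : ℝ} (hc : 0 ≤ c) : 0 < v c := by
  unfold v
  exact div_pos one_pos (by linarith)

/-- `Φ₁(c) > 0` for `0 ≤ c`, `6c < 1`. [folklore] -/
theorem Phi1_pos {c : ℝ} (h0 : 0 ≤ c) (hc : 6 * c < 1) : 0 < Phi1 c := by
  unfold Phi1
  have hu := u_pos hc
  have hv := v_pos h0
  positivity

/-- `Φ₂(c) > 0` for `0 ≤ c`, `6c < 1`. [folklore] -/
theorem Phi2_pos {c : ℝ} (h0 : 0 ≤ c) (hc : 6 * c < 1) : 0 < Phi2 c := by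
  unfold Phi2
  have hu := u_pos hc
  have hv := v_pos h0
  positivity

/-- **Monotonicity**: for `0 ≤ β < 2/3`, `R` is non-decreasing in each of `τ₅, κ_q, Λ₃`, so certified
UPPER bounds of the three constants may be substituted. [folklore] -/
theorem starR_mono {β τ₅ τ₅' κq κq' Λ₃ Λ₃' : ℝ} (h0 : 0 ≤ β) (h23 : β < 2 / 3)
    (hτ : τ₅ ≤ τ₅') (hκ : κq ≤ κq') (hΛ : Λ₃ ≤ Λ₃') :
    starR β τ₅ κq Λ₃ ≤ starR β τ₅' κq' Λ₃' := by
  have hc0 : 0 ≤ β / 4 := by positivity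
  have hc1 : 6 * (β / 4) < 1 := by linarith
  have h1 : 0 < Phi1 (β / 4) := Phi1_pos hc0 hc1
  have h2 : 0 < Phi2 (β / 4) := Phi2_pos hc0 hc1
  rw [starR_eq_affine, starR_eq_affine]
  have a1 : Phi1 (β / 4) * β / 4 * τ₅ ≤ Phi1 (β / 4) * β / 4 * τ₅' :=
    mul_le_mul_of_nonneg_left hτ (by positivity)
  have a2 : Phi1 (β / 4) * β * (β / 4) * κq ≤ Phi1 (β / 4) * β * (β / 4) * κq' :=
    mul_le_mul_of_nonneg_left hκ (by positivity)
  have a3 : (Phi1 (β / 4) / 6 + Phi2 (β / 4) / 3) * β ^ 3 * Λ₃ ≤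
      (Phi1 (β / 4) / 6 + Phi2 (β / 4) / 3) * β ^ 3 * Λ₃' :=
    mul_le_mul_of_nonneg_left hΛ (by positivity)
  linarith

/-- **Generic row lemma**: if the constants are below given bounds and the closed form at the
bounds is `< 1`, then `R < 1`. [folklore] -/
theorem starR_lt_one_of_le {β τ₅ κq Λ₃ T K L : ℝ} (h0 : 0 ≤ β) (h23 : β < 2 / 3)
    (hτ : τ₅ ≤ T) (hκ : κq ≤ K) (hΛ : Λ₃ ≤ L) (hrow : starR β T K L < 1) :
    starR β τ₅ κq Λ₃ < 1 :=
  lt_of_le_of_lt (starR_mono h0 h23 hτ hκ hΛ) hrow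

/-! ### The rows (certified constants of `STAR-CERT.md`: `κ_q ≤ 0.336`, `Λ₃ ≤ 0.066`, `τ₅` per row) -/

/-- Row `β_W = 2/9` (the single-site front; here `R ≤ 0.656`): `τ(10/9) ≤ 0.2646`. [folklore] -/
theorem starR_twoNinths_lt_one {τ₅ κq Λ₃ : ℝ} (hτ : τ₅ ≤ 2646 / 10000) (hκ : κq ≤ 336 / 1000)
    (hΛ : Λ₃ ≤ 66 / 1000) : starR (2 / 9) τ₅ κq Λ₃ < 1 :=
  starR_lt_one_of_le (by norm_num) (by norm_num) hτ hκ hΛ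
    (by unfold starR Bcoef Pcoef Phi1 Phi2 u v; norm_num)

/-- Row `β_W = 1/4` (`R ≤ 0.811`): `τ(5/4) ≤ 0.2940`. [folklore] -/
theorem starR_quarter_lt_one {τ₅ κq Λ₃ : ℝ} (hτ : τ₅ ≤ 2940 / 10000) (hκ : κq ≤ 336 / 1000)
    (hΛ : Λ₃ ≤ 66 / 1000) : starR (1 / 4) τ₅ κq Λ₃ < 1 :=
  starR_lt_one_of_le (by norm_num) (by norm_num) hτ hκ hΛ
    (by unfold starR Bcoef Pcoef Phi1 Phi2 u v; norm_num)

/-- Row `β_W = 4/15` (the SC-b front; `R ≤ 0.917`): `τ(4/3) ≤ 0.3111`. [folklore] -/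
theorem starR_fourFifteenths_lt_one {τ₅ κq Λ₃ : ℝ} (hτ : τ₅ ≤ 3111 / 10000)
    (hκ : κq ≤ 336 / 1000) (hΛ : Λ₃ ≤ 66 / 1000) : starR (4 / 15) τ₅ κq Λ₃ < 1 :=
  starR_lt_one_of_le (by norm_num) (by norm_num) hτ hκ hΛ
    (by unfold starR Bcoef Pcoef Phi1 Phi2 u v; norm_num)

/-- Row `β_W = 27/100` (`R ≤ 0.939`): `τ(27/20) ≤ 0.3145`. [folklore] -/
theorem starR_27_100_lt_one {τ₅ κq Λ₃ : ℝ} (hτ : τ₅ ≤ 3145 / 10000) (hκ : κq ≤ 336 / 1000)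
    (hΛ : Λ₃ ≤ 66 / 1000) : starR (27 / 100) τ₅ κq Λ₃ < 1 :=
  starR_lt_one_of_le (by norm_num) (by norm_num) hτ hκ hΛ
    (by unfold starR Bcoef Pcoef Phi1 Phi2 u v; norm_num)

/-- Row `β_W = 11/40 = 0.275` (the headline row; `R ≤ 0.974`): `τ(11/8) ≤ 0.3196`. [folklore] -/
theorem starR_11_40_lt_one {τ₅ κq Λ₃ : ℝ} (hτ : τ₅ ≤ 3196 / 10000) (hκ : κq ≤ 336 / 1000)
    (hΛ : Λ₃ ≤ 66 / 1000) : starR (11 / 40) τ₅ κq Λ₃ < 1 :=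
  starR_lt_one_of_le (by norm_num) (by norm_num) hτ hκ hΛ
    (by unfold starR Bcoef Pcoef Phi1 Phi2 u v; norm_num)

/-- Row `β_W = 277/1000` (the last row with margin `≥ 0.01`; `R ≤ 0.988`): `τ(277/200) ≤ 0.3216`.
[folklore] -/
theorem starR_277_1000_lt_one {τ₅ κq Λ₃ : ℝ} (hτ : τ₅ ≤ 3216 / 10000) (hκ : κq ≤ 336 / 1000)
    (hΛ : Λ₃ ≤ 66 / 1000) : starR (277 / 1000) τ₅ κq Λ₃ < 1 :=
  starR_lt_one_of_le (by norm_num) (by norm_num) hτ hκ hΛ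
    (by unfold starR Bcoef Pcoef Phi1 Phi2 u v; norm_num)

/-- Row `β_W = 139/500 = 0.278` (margin `0.005`; `R ≤ 0.995`): `τ(139/100) ≤ 0.3226`. [folklore] -/
theorem starR_139_500_lt_one {τ₅ κq Λ₃ : ℝ} (hτ : τ₅ ≤ 3226 / 10000) (hκ : κq ≤ 336 / 1000)
    (hΛ : Λ₃ ≤ 66 / 1000) : starR (139 / 500) τ₅ κq Λ₃ < 1 :=
  starR_lt_one_of_le (by norm_num) (by norm_num) hτ hκ hΛ
    (by unfold starR Bcoef Pcoef Phi1 Phi2 u v; norm_num)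

/-- **Where this bookkeeping ends**: at `β_W = 2/7` the received sum is `≥ 1` as soon as
`τ₅ ≥ 0.33`, `κ_q ≥ 1/3`, `Λ₃ ≥ 0` (the true constants satisfy `τ(10/7) ≥ 0.330`, `κ_q = √(V₄/3) ≥ 1/3`
since `V₄ ≥ V₄(Haar) = 1/3`): the star door of Lemma S does not open at `2/7`. [folklore] -/
theorem one_le_starR_twoSevenths_of_ge {τ₅ κq Λ₃ : ℝ} (hτ : 33 / 100 ≤ τ₅) (hκ : 1 / 3 ≤ κq)
    (hΛ : 0 ≤ Λ₃) : 1 ≤ starR (2 / 7) τ₅ κq Λ₃ := by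
  have hrow : 1 ≤ starR (2 / 7) (33 / 100) (1 / 3) 0 := by
    unfold starR Bcoef Pcoef Phi1 Phi2 u v; norm_num
  exact hrow.trans (starR_mono (by norm_num) (by norm_num) hτ hκ hΛ)

/-! ### Rows of REFINEMENT A (the comparison theorem with state-averaged defects)

In the cell's refinement A (`STAR-PROOF.md` P9) the one-site weight of the partner link is taken
with Dobrushin/Föllmer defects AVERAGED under the compared state, so the slot `τ₅` of `starR`
holds an upper bound of `E_ν τ(|r|)` instead of `sup τ(|r|) = τ(5β)`:
`E_ν τ(|r|) ≤ s/4` with `s = β√(5 + 20τ(6β))` (using `τ(κ) ≤ κ/4`, implied by the kernel quarter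
modulus), or `≤ ℓ(s)` for a certified affine majorant `ℓ ≥ τ` on `[0, 5β]`. The closed form is
unchanged, so the rows below are again pure arithmetic; the analytic statement is NOT asserted. -/

/-- Row `β_W = 7/25 = 0.28` of refinement A (`R ≤ 0.954`): the averaged partner weight
`E_ν τ(|r|) ≤ s/4 ≤ 0.2481` (elementary majorant `τ(κ) ≤ κ/4`; cell table `cert_star_v2_out.json`).
[folklore] -/
theorem starR_7_25_lt_one_of_avg {τ₅ κq Λ₃ : ℝ} (hτ : τ₅ ≤ 2481 / 10000) (hκ : κq ≤ 336 / 1000)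
    (hΛ : Λ₃ ≤ 66 / 1000) : starR (7 / 25) τ₅ κq Λ₃ < 1 :=
  starR_lt_one_of_le (by norm_num) (by norm_num) hτ hκ hΛ
    (by unfold starR Bcoef Pcoef Phi1 Phi2 u v; norm_num)

/-- Row `β_W = 2/7` of refinement A (`R ≤ 0.987`, margin `0.013`): the averaged partner weight
`E_ν τ(|r|) ≤ ℓ(s) ≤ 0.2447` (certified tangent majorant of `τ` on `[0, 10/7]`). With the
elementary majorant (`τ₅ ≤ 0.2544`) the closed form is `≤ 0.9943`, see the next row. [folklore] -/
theorem starR_twoSevenths_lt_one_of_avg {τ₅ κq Λ₃ : ℝ} (hτ : τ₅ ≤ 2447 / 10000)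
    (hκ : κq ≤ 336 / 1000) (hΛ : Λ₃ ≤ 66 / 1000) : starR (2 / 7) τ₅ κq Λ₃ < 1 :=
  starR_lt_one_of_le (by norm_num) (by norm_num) hτ hκ hΛ
    (by unfold starR Bcoef Pcoef Phi1 Phi2 u v; norm_num)

/-- Row `β_W = 2/7` of refinement A with the ELEMENTARY averaged weight `s/4 ≤ 0.2544`
(`R ≤ 0.9943`, margin `0.006`). [folklore] -/
theorem starR_twoSevenths_lt_one_of_avg_elem {τ₅ κq Λ₃ : ℝ} (hτ : τ₅ ≤ 2544 / 10000)
    (hκ : κq ≤ 336 / 1000) (hΛ : Λ₃ ≤ 66 / 1000) : starR (2 / 7) τ₅ κq Λ₃ < 1 :=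
  starR_lt_one_of_le (by norm_num) (by norm_num) hτ hκ hΛ
    (by unfold starR Bcoef Pcoef Phi1 Phi2 u v; norm_num)

end Summit.Ventures.YMGap.StarWindow

end
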